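import Literature.MathematicalPhysics.QuantumChemistry.RelaxationEnergyHierarchy
import HarnessLib

/-!
# Ventures/CertifiedQuantumChemistry — Rows/PrimalFeasibleCeiling.lean: the ORDER-DUAL soundness lemma —
# one certified PRIMAL-feasible point of a relaxation is a CEILING on every DUAL certificate of that
# relaxation, and brackets the relaxation optimum (LADDER-CHEM I-TYPE slot 07, «GAP-FLOOR» reading)

HONEST FRAMING (verbatim, page 1 of every file of the cell): certified bounds for a stated model
Hamiltonian in a stated basis; not a claim about the real molecule or material beyond that model.
Everything in this file is about the OPTIMUM `p*` OF A RELAXATION (an SDP value), never about `E₀`: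
a primal-feasible point bounds `p*` from above and says NOTHING about the ground-state energy
(census-neutral by construction — director-chem g14 WORD #14 (3), INBOX 2026-08-30T04:00:47Z).

WHAT THIS FILE IS. The cell's LOWER rows are dual-side: a certificate proves `lo ≤ Re E(γ, Γ)` on the
whole feasible set of a relaxation indexed by a condition set `P` on RDM pairs (the claim-node shape of
`Certificates/*.lean`, e.g. `∀ γ Γ, IsDQGT1T2PrimeFeasibleSector 10 9 γ Γ → lo ≤ Re E(γ, Γ)`). The
«GAP-FLOOR» object (chem-solver-4 OFFER S«03:56:57Z», director kit line D-GF) is primal-side: ONE pair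
`(γ̂, Γ̂)` satisfying `P` with its functional value computed exactly, `Re E(γ̂, Γ̂) ≤ Pval`. Weak duality
read in the ORDER direction (Jansson–Chaykin–Keil (1.4) `d* ≤ p*` and Thm 4.1 `p* ≤ ⟨C, X̂⟩` for a
primal-feasible `X̂`; tree `Literature.Computation.Certificates.JanssonChaykinKeil.theorem_4_1` at the
matrix level) gives, at the RDM level and for an ARBITRARY condition set `P` (no new definition; the
hypotheses are written out in every signature):

§1 generic `P`: `dualBound_le_of_feasible` (`lo ≤ Pval` for every dual-side bound `lo` — «every
   multiplier certificate on this file obeys `lo ≤ P`»); `sub_le_width_of_feasible` (its width form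
   `U − Pval ≤ U − lo` for any reference `U` — «`W_cert ≥ U − P`»); `sInf_le_of_feasible` /
   `le_sInf_of_dualBound` / `sInf_mem_Icc_of_dualBound_of_feasible` (the relaxation optimum
   `p*_P = sInf {Re E | P}` is BRACKETED: `lo ≤ p*_P ≤ Pval`).
§2 the tree's named sector values (`RelaxationEnergyHierarchy`): `pqgT1T2pSectorEnergy_le_of_feasible`,
   `le_pqgT1T2pSectorEnergy_of_dualBound`, `pqgT1T2pSectorEnergy_mem_Icc` (`DQGT1T2′`, the rung of
   rows #308/#350/#354) and the `DQG` twins `pqgSectorEnergy_le_of_feasible`,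
   `le_pqgSectorEnergy_of_dualBound`, `pqgSectorEnergy_mem_Icc`.

Everything is PROVED (0 sorry, standard axioms), theorems only; nothing is keyed to it (WORD #14: «the
one-line order-dual soundness lemma is welcome at your pace; nothing keyed to it»); no row, node or
CERTIFIED cell depends on it. WHAT THIS IS NOT: not a bound on `E₀`, not a row, not a statement that any
particular primal point exists (that is a reader-side certificate: exact `E ŷ = rhs`, blocks `⪰ 0` by
rigorous Cholesky, `P = c·ŷ + c₀` exact).

References: C. Jansson, D. Chaykin, C. Keil, *Rigorous error bounds for the optimal value in semidefinite
programming*, SIAM J. Numer. Anal. 46 (2007/08) 180–200, (1.4) and Thm 4.1 [JanssonChaykinKeil2008];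
M. Nakata, B. J. Braams, K. Fujisawa, M. Fukuda, J. K. Percus, M. Yamashita, Z. Zhao, J. Chem. Phys. 128
(2008) 164113 §II.A–C (the sector programmes) [NakataEtAl2008]. Tree (REUSED, not restated): `rdmEnergy`,
`IsDQGFeasibleSector`, `IsDQGT1T2PrimeFeasibleSector`, `pqgSectorEnergy`, `pqgT1T2pSectorEnergy` and their
`…_le_rdmEnergy` / `…Set_nonempty` / `…Set_bddBelow` lemmas.
-/

noncomputable section

namespace Summit.Ventures.CertifiedQuantumChemistry

open Matrix Literature.MathematicalPhysics.QuantumLattice Literature.MathematicalPhysics.QuantumChemistry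

variable {Λ : Type*} [LinearOrder Λ] [Fintype Λ]

/-! ### §1 Generic condition set `P` -/

section Generic

variable (P : Matrix (Orb Λ) (Orb Λ) ℂ → Matrix (Orb Λ × Orb Λ) (Orb Λ × Orb Λ) ℂ → Prop)
  (h : Λ → Λ → ℂ) (g : Λ → Λ → Λ → Λ → ℂ) (c : ℂ)

omit [LinearOrder Λ] in
/-- **Order-dual soundness (primal ceiling on every dual certificate).** If ONE pair `(γ̂, Γ̂)` satisfies
the relaxation's condition set `P` and its functional value is at most `Pval`, then every dual-side bound
`lo` — any number below the functional on the WHOLE `P`-feasible set, the claim-node shape of the cell's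
LOWER certificates — satisfies `lo ≤ Pval`. Jansson–Chaykin–Keil (1.4) «`bᵀỹ ≤ ⟨C, X⟩` for dual-feasible
`ỹ` and primal-feasible `X`, hence `d* ≤ p*`», read at the RDM level for an arbitrary condition set.
[cite: JanssonChaykinKeil2008, (1.4)] -/
theorem dualBound_le_of_feasible {lo Pval : ℝ} {γ : Matrix (Orb Λ) (Orb Λ) ℂ}
    {Γ : Matrix (Orb Λ × Orb Λ) (Orb Λ × Orb Λ) ℂ} (hP : P γ Γ) (hE : (rdmEnergy h g c γ Γ).re ≤ Pval)
    (hlo : ∀ γ Γ, P γ Γ → lo ≤ (rdmEnergy h g c γ Γ).re) : lo ≤ Pval :=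
  (hlo γ Γ hP).trans hE

omit [LinearOrder Λ] in
/-- **Width form («`W_cert ≥ U − P`»).** For any reference value `U` (e.g. the certified upper half on the
same key), a `P`-feasible pair of value `≤ Pval` forces `U − Pval ≤ U − lo` for every dual-side bound `lo`
of the `P`-relaxation: no certificate of this relaxation can close the bracket below the floor `U − Pval`.
[cite: JanssonChaykinKeil2008, (1.4)] -/
theorem sub_le_width_of_feasible {lo Pval : ℝ} {γ : Matrix (Orb Λ) (Orb Λ) ℂ}
    {Γ : Matrix (Orb Λ × Orb Λ) (Orb Λ × Orb Λ) ℂ} (hP : P γ Γ) (hE : (rdmEnergy h g c γ Γ).re ≤ Pval)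
    (hlo : ∀ γ Γ, P γ Γ → lo ≤ (rdmEnergy h g c γ Γ).re) (U : ℝ) : U - Pval ≤ U - lo :=
  sub_le_sub_left (dualBound_le_of_feasible P h g c hP hE hlo) U

omit [LinearOrder Λ] in
/-- **Jansson–Chaykin–Keil Thm 4.1 at the RDM level**: a `P`-feasible pair of value `≤ Pval` bounds the
relaxation optimum `p*_P = inf {Re E(γ, Γ) : P γ Γ}` from above, `p*_P ≤ Pval` (feasible values bounded
below, e.g. by any dual certificate). [cite: JanssonChaykinKeil2008, Thm 4.1, (4.1)–(4.3)] -/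
theorem sInf_le_of_feasible {Pval : ℝ} {γ : Matrix (Orb Λ) (Orb Λ) ℂ}
    {Γ : Matrix (Orb Λ × Orb Λ) (Orb Λ × Orb Λ) ℂ}
    (hbdd : BddBelow {E : ℝ | ∃ γ Γ, P γ Γ ∧ E = (rdmEnergy h g c γ Γ).re})
    (hP : P γ Γ) (hE : (rdmEnergy h g c γ Γ).re ≤ Pval) :
    sInf {E : ℝ | ∃ γ Γ, P γ Γ ∧ E = (rdmEnergy h g c γ Γ).re} ≤ Pval :=
  (csInf_le hbdd ⟨γ, Γ, hP, rfl⟩).trans hE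

omit [LinearOrder Λ] in
/-- The dual side of the same bracket: a dual-side bound `lo` (below the functional on the whole
`P`-feasible set, assumed non-empty) lies below the relaxation optimum, `lo ≤ p*_P` («`d* ≤ p*`»).
[cite: JanssonChaykinKeil2008, (1.4)] -/
theorem le_sInf_of_dualBound {lo : ℝ}
    (hne : {E : ℝ | ∃ γ Γ, P γ Γ ∧ E = (rdmEnergy h g c γ Γ).re}.Nonempty)
    (hlo : ∀ γ Γ, P γ Γ → lo ≤ (rdmEnergy h g c γ Γ).re) :
    lo ≤ sInf {E : ℝ | ∃ γ Γ, P γ Γ ∧ E = (rdmEnergy h g c γ Γ).re} := by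
  refine le_csInf hne ?_
  rintro E ⟨γ, Γ, hf, rfl⟩
  exact hlo γ Γ hf

omit [LinearOrder Λ] in
/-- **The relaxation optimum is BRACKETED** by a dual certificate `lo` and a primal-feasible value `Pval`:
`p*_P ∈ [lo, Pval]` — the «GAP-FLOOR» reading `p* ∈ [L, P]` for an arbitrary condition set `P`.
[cite: JanssonChaykinKeil2008, (1.4) and Thm 4.1] -/
theorem sInf_mem_Icc_of_dualBound_of_feasible {lo Pval : ℝ} {γ : Matrix (Orb Λ) (Orb Λ) ℂ}
    {Γ : Matrix (Orb Λ × Orb Λ) (Orb Λ × Orb Λ) ℂ}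
    (hbdd : BddBelow {E : ℝ | ∃ γ Γ, P γ Γ ∧ E = (rdmEnergy h g c γ Γ).re})
    (hlo : ∀ γ Γ, P γ Γ → lo ≤ (rdmEnergy h g c γ Γ).re)
    (hP : P γ Γ) (hE : (rdmEnergy h g c γ Γ).re ≤ Pval) :
    sInf {E : ℝ | ∃ γ Γ, P γ Γ ∧ E = (rdmEnergy h g c γ Γ).re} ∈ Set.Icc lo Pval :=
  ⟨le_sInf_of_dualBound P h g c ⟨_, γ, Γ, hP, rfl⟩ hlo, sInf_le_of_feasible P h g c hbdd hP hE⟩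

end Generic

/-! ### §2 The tree's named sector values: `DQGT1T2′` and `DQG` -/

section Named

variable (h : Λ → Λ → ℂ) (g : Λ → Λ → Λ → Λ → ℂ) (c : ℂ)

/-- `DQGT1T2′` sector programme (the rung of rows #308/#350/#354): a sector-`DQGT1T2′`-feasible pair at
`(a, b)` of value `≤ Pval` gives `E_PQGT1T2′(a, b) ≤ Pval` (the tree's `pqgT1T2pSectorEnergy`).
[cite: JanssonChaykinKeil2008, Thm 4.1] -/
theorem pqgT1T2pSectorEnergy_le_of_feasible {a b : ℕ} {Pval : ℝ} {γ : Matrix (Orb Λ) (Orb Λ) ℂ}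
    {Γ : Matrix (Orb Λ × Orb Λ) (Orb Λ × Orb Λ) ℂ} (hf : IsDQGT1T2PrimeFeasibleSector a b γ Γ)
    (hE : (rdmEnergy h g c γ Γ).re ≤ Pval) : pqgT1T2pSectorEnergy h g c a b ≤ Pval :=
  (pqgT1T2pSectorEnergy_le_rdmEnergy h g c hf).trans hE

/-- `DQGT1T2′` sector programme, dual side: the claim-node hypothesis of a full-cone LOWER certificate at
`(a, b)` (`∀ γ Γ, IsDQGT1T2PrimeFeasibleSector a b γ Γ → lo ≤ Re E(γ, Γ)`, `a, b ≤ |Λ|`) gives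
`lo ≤ E_PQGT1T2′(a, b)`. [cite: NakataEtAl2008, §II.C] -/
theorem le_pqgT1T2pSectorEnergy_of_dualBound {a b : ℕ} (ha : a ≤ Fintype.card Λ)
    (hb : b ≤ Fintype.card Λ) {lo : ℝ}
    (hlo : ∀ γ Γ, IsDQGT1T2PrimeFeasibleSector a b γ Γ → lo ≤ (rdmEnergy h g c γ Γ).re) :
    lo ≤ pqgT1T2pSectorEnergy h g c a b :=
  le_sInf_of_dualBound (IsDQGT1T2PrimeFeasibleSector a b) h g c
    (pqgT1T2pSectorEnergySet_nonempty h g c ha hb) hlo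

/-- `DQGT1T2′` sector programme: the optimum is BRACKETED, `E_PQGT1T2′(a, b) ∈ [lo, Pval]`, by a full-cone
LOWER certificate `lo` and ONE certified feasible pair of value `≤ Pval` («GAP-FLOOR»: `p* ∈ [L, P]`;
`a, b ≤ |Λ|`). [cite: JanssonChaykinKeil2008, (1.4) and Thm 4.1] -/
theorem pqgT1T2pSectorEnergy_mem_Icc {a b : ℕ} (ha : a ≤ Fintype.card Λ) (hb : b ≤ Fintype.card Λ)
    {lo Pval : ℝ} {γ : Matrix (Orb Λ) (Orb Λ) ℂ} {Γ : Matrix (Orb Λ × Orb Λ) (Orb Λ × Orb Λ) ℂ}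
    (hlo : ∀ γ Γ, IsDQGT1T2PrimeFeasibleSector a b γ Γ → lo ≤ (rdmEnergy h g c γ Γ).re)
    (hf : IsDQGT1T2PrimeFeasibleSector a b γ Γ) (hE : (rdmEnergy h g c γ Γ).re ≤ Pval) :
    pqgT1T2pSectorEnergy h g c a b ∈ Set.Icc lo Pval :=
  ⟨le_pqgT1T2pSectorEnergy_of_dualBound h g c ha hb hlo, pqgT1T2pSectorEnergy_le_of_feasible h g c hf hE⟩

/-- `DQG` sector programme (rows #9/#10/#93 rung): a sector-`DQG`-feasible pair at `(a, b)` of value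
`≤ Pval` gives `E_PQG(a, b) ≤ Pval` (the tree's `pqgSectorEnergy`). [cite: JanssonChaykinKeil2008, Thm 4.1] -/
theorem pqgSectorEnergy_le_of_feasible {a b : ℕ} {Pval : ℝ} {γ : Matrix (Orb Λ) (Orb Λ) ℂ}
    {Γ : Matrix (Orb Λ × Orb Λ) (Orb Λ × Orb Λ) ℂ} (hf : IsDQGFeasibleSector a b γ Γ)
    (hE : (rdmEnergy h g c γ Γ).re ≤ Pval) : pqgSectorEnergy h g c a b ≤ Pval :=
  (pqgSectorEnergy_le_rdmEnergy h g c hf).trans hE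

/-- `DQG` sector programme, dual side: `∀ γ Γ, IsDQGFeasibleSector a b γ Γ → lo ≤ Re E(γ, Γ)` (`a, b ≤ |Λ|`)
gives `lo ≤ E_PQG(a, b)` (one direction of the tree's `le_pqgSectorEnergy_iff`). [cite: NakataEtAl2008, §II.C] -/
theorem le_pqgSectorEnergy_of_dualBound {a b : ℕ} (ha : a ≤ Fintype.card Λ) (hb : b ≤ Fintype.card Λ)
    {lo : ℝ} (hlo : ∀ γ Γ, IsDQGFeasibleSector a b γ Γ → lo ≤ (rdmEnergy h g c γ Γ).re) :
    lo ≤ pqgSectorEnergy h g c a b :=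
  (le_pqgSectorEnergy_iff h g c ha hb).2 hlo

/-- `DQG` sector programme: `E_PQG(a, b) ∈ [lo, Pval]` from a LOWER certificate `lo` and ONE certified
feasible pair of value `≤ Pval` (`a, b ≤ |Λ|`). [cite: JanssonChaykinKeil2008, (1.4) and Thm 4.1] -/
theorem pqgSectorEnergy_mem_Icc {a b : ℕ} (ha : a ≤ Fintype.card Λ) (hb : b ≤ Fintype.card Λ)
    {lo Pval : ℝ} {γ : Matrix (Orb Λ) (Orb Λ) ℂ} {Γ : Matrix (Orb Λ × Orb Λ) (Orb Λ × Orb Λ) ℂ}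
    (hlo : ∀ γ Γ, IsDQGFeasibleSector a b γ Γ → lo ≤ (rdmEnergy h g c γ Γ).re)
    (hf : IsDQGFeasibleSector a b γ Γ) (hE : (rdmEnergy h g c γ Γ).re ≤ Pval) :
    pqgSectorEnergy h g c a b ∈ Set.Icc lo Pval :=
  ⟨le_pqgSectorEnergy_of_dualBound h g c ha hb hlo, pqgSectorEnergy_le_of_feasible h g c hf hE⟩

end Named

end Summit.Ventures.CertifiedQuantumChemistry

end
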